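import Mathlib
import HarnessLib
import Literature.Computability.MetaComplexity.LowDegreeClosure
import Literature.Computability.MetaComplexity.SmolenskyProperty
import Literature.Computability.MetaComplexity.SmolenskyParity
import Summits.QuantumAdvantage.AdviceFreeQNC0.OddPrimeStatements
import Summits.QuantumAdvantage.AdviceFreeQNC0.TwoClassAvoidance
import Summits.QuantumAdvantage.QuantumAdvantage.Theorems.MobiusLadderDigitPolyUniformityLARChooseMiddleLe
import Summits.QuantumAdvantage.QuantumAdvantage.Theses.PolyFeatureDial
import Summits.QuantumAdvantage.QuantumAdvantage.Theorems.ParityPinning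

/-!
# RelativeSmolensky — the RELATIVE Smolensky law is a theorem (lens-4 gen 9 «HilbertDial», cell decomp-qadv)

LANDS AFTER `Theorems/ParityPinning.lean` (lens-4 g5) and extends its namespace.  Closes BY NAME:

* item **29180** `PolyFeatureDial.RelSmolOdd`         — `relSmolOdd_item_holds`;
* item **28532** `PolyFeatureDial.FeatureRungPolyOdd`  — `featureRungPolyOdd_holds` (the blocker crux of the born route
  `route-QuantumAdvantage-PolyFeatureDial`; via the landed edge `featureRungPolyOdd_of_relSmol` of `ParityPinning`);
* and records `closes_residual : PolyFeatureDial.PolyFeatureShadow → AdviceFreeQNC0Odd` — after this file the route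
  `PolyFeatureDial` has NO open piece except its declared residual 28533.

## The theorem

For an odd prime `p`, every `R ≥ 2`, and every Boolean `f` on `m ≥ 4(R+1)²(d+1)²` bits of `𝔽_p`-degree `≤ d`
(`HasDegF p f d`), the level set `S = {f = true}` satisfies `#(S ∩ ODD) ≤ R·#(S ∩ EVEN)` and `#(S ∩ EVEN) ≤ R·#(S ∩ ODD)`
(`relBal_of_sq_le`; ratio `3` already from `m ≥ 16(d+1)²`, `relBal_three_of_sq_le`).  Smolensky's bound
`|#(S∩ODD) − #(S∩EVEN)| ≤ d·C(m, m/2)` is ABSOLUTE (vacuous for sparse `S`); this one is RELATIVE to `|S|` at every density.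

## The mechanism — the Hilbert function of the level set, folded along parity

`N = |S|`, `h_S(k) = hilbertFn 𝔽_p S k` (tree `LowDegreeClosure`):
* (FOLDING)  on a parity class `y^T = ±y^{Tᶜ}`, so degree-`⌊m/2⌋` polynomials restricted to `S ∩ ODD` span everything:
  `#(S ∩ ODD), #(S ∩ EVEN) ≤ h_S(⌊m/2⌋)`                                      (`card_parityPart_le_hilbertFn`);
* (SYMMETRY — the only use of `deg f ≤ d`) `𝟙_S·P` has degree `≤ d + k`, so for `deg Q ≤ k'` with `k + k' + d < m`
  the alternating sum `Σ_x ḡ(x)(𝟙_S P)(x)(𝟙_S Q)(x)` vanishes: `{𝟙_S P} ⊥ ḡ·{𝟙_S Q}` in `𝔽_p^S`, hence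
  `h_S(k) + h_S(k') ≤ N`                                  (`hilbertFn_add_hilbertFn_le`, a `dualAnnihilator` count);
* (DENSITY)  `2^m · h_S(k) ≥ N · Σ_{j ≤ k} C(m, j)`     (tree `numMonomials_mul_card_le_two_pow_mul_hilbertFn`, Nie–Wang);
* (TAIL)     `(R+1) · Σ_{j ≤ ⌈m/2⌉−1−d} C(m, j) ≥ 2^m` for `m ≥ 4(R+1)²(d+1)²`   (`(2a+1)·C(2a,a)² ≤ 16^a`).
So `max(#odd, #even) ≤ N − h_S(⌈m/2⌉ − 1 − d) ≤ N·R/(R+1)`.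

Sources: R. Smolensky, STOC 1987 (doi:10.1145/28395.28404); Z. Nie, A. Y. Wang, J. Comb. Theory A 134 (2015) (Hilbert
functions and the finite-degree Zariski closure — the tree's `LowDegreeClosure`); S. Kopparty, S. Srinivasan, Theory of
Computing 14(12) (2018) (certifying polynomials: the density bound).  0 `sorry`; axioms `propext`, `Classical.choice`,
`Quot.sound`.  Node record: HOME/decomp-qadv-lens-4/g9/NODE-g9.md (lineage file `g9/HilbertDial.lean`, §36–§37).
-/

set_option linter.dupNamespace false -- D-0017: single-problem summit ⇒ `QuantumAdvantage.QuantumAdvantage` by design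
noncomputable section

namespace Summit.QuantumAdvantage.QuantumAdvantage.Theorems.PairFreezing
open Classical Finset Summit.QuantumAdvantage.AdviceFreeQNC0
open Literature.Computability.MetaComplexity Literature.Computability.MetaComplexity.Smolensky
open Literature.Computability.Complexity (parityFn)
open Summit.QuantumAdvantage.QuantumAdvantage.Theses

/-! ### §13 The purity dial (game-free side): ratio `R`, threshold `τ` -/

section Dial

variable {m : ℕ}


/-- the odd-parity part of the level set `{f = true}`. -/
def oddPart (f : (Fin m → Bool) → Bool) : Finset (Fin m → Bool) :=
  univ.filter fun z => f z = true ∧ parityFn m z = true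

/-- the even-parity part of the level set `{f = true}`. -/
def evenPart (f : (Fin m → Bool) → Bool) : Finset (Fin m → Bool) :=
  univ.filter fun z => f z = true ∧ parityFn m z = false

/-- **`RelBal R f`** — the level set of `f` is PARITY-BALANCED IN RATIO `R`: its odd and even parts are within a
factor `R` of each other (relative parity bias `≤ (R−1)/(R+1)`).  `R = 3` is g5's `Balanced`/`RelSmolensky` ratio;
`R → ∞` is NEAR-PURITY-freeness; exact purity (one part empty, the other not) violates every `R`. -/
def RelBal (R : ℕ) (f : (Fin m → Bool) → Bool) : Prop :=
  (oddPart f).card ≤ R * (evenPart f).card ∧ (evenPart f).card ≤ R * (oddPart f).card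



/-- the level set splits into its two parity parts. -/
theorem card_level_eq (f : (Fin m → Bool) → Bool) :
    (univ.filter fun z => f z = true).card = (oddPart f).card + (evenPart f).card := by
  unfold oddPart evenPart
  rw [← card_union_of_disjoint]
  · congr 1; ext z; simp only [mem_union, mem_filter, mem_univ, true_and]; cases parityFn m z <;> simp
  · exact disjoint_filter.2 fun z _ h1 h2 => by rw [h1.2] at h2; exact Bool.noConfusion h2.2

end Dial


/-- the alternating sum of a function of degree `< q` over `{0,1}^q` vanishes. -/
theorem altSum_eq_zero (p : ℕ) [Fact p.Prime] {q D : ℕ} (hD : D < q) {G : CubeFn (ZMod p) q}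
    (hG : G ∈ lowDeg (ZMod p) q D) :
    ∑ y : Fin q → Bool, (if parityFn q y = true then (-1 : ZMod p) else 1) * G y = 0 := by
  rw [lowDeg_eq_span] at hG
  induction hG using Submodule.span_induction with
  | mem Q hQ =>
    obtain ⟨⟨S, hS⟩, rfl⟩ := hQ
    -- a coordinate outside `S`
    obtain ⟨k, -, hk⟩ := Finset.exists_mem_notMem_of_card_lt_card
      (s := S) (t := (univ : Finset (Fin q))) (by
        rw [Finset.card_univ, Fintype.card_fin]; omega)
    refine Finset.sum_ninvolution (fun y => Function.update y k (!y k)) ?_ ?_ (fun _ => mem_univ _) ?_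
    · intro y
      have hmono : mono (ZMod p) S (Function.update y k (!y k)) = mono (ZMod p) S y := by
        simp only [mono_apply]
        have hiff : (∀ i ∈ S, Function.update y k (!y k) i = true) ↔ ∀ i ∈ S, y i = true := by
          refine forall₂_congr fun i hi => ?_
          rw [Function.update_of_ne (fun h : i = k => hk (h ▸ hi))]
        by_cases h : ∀ i ∈ S, y i = true
        · rw [if_pos h, if_pos (hiff.2 h)]
        · rw [if_neg h, if_neg (mt hiff.1 h)]
      simp only [parityFn_update_not, hmono]
      cases parityFn q y <;> simp
    · intro y _ h
      have := congrFun h k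
      simp at this
    · intro y
      funext i
      by_cases hi : i = k
      · subst hi; simp
      · simp [Function.update_of_ne hi]
  | zero => simp
  | add Q R _ _ hQ hR =>
    simp only [Pi.add_apply, mul_add, Finset.sum_add_distrib, hQ, hR, add_zero]
  | smul a Q _ hQ =>
    simp only [Pi.smul_apply, smul_eq_mul]
    calc ∑ y : Fin q → Bool, (if parityFn q y = true then (-1 : ZMod p) else 1) * (a * Q y)
        = a * ∑ y : Fin q → Bool, (if parityFn q y = true then (-1 : ZMod p) else 1) * Q y := by
          rw [Finset.mul_sum]; exact Finset.sum_congr rfl fun y _ => by ring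
      _ = 0 := by rw [hQ, mul_zero]

/-! ## §14 THE HILBERT LAW — relative Smolensky at quadratic threshold (PROVED)

For an odd prime `p` and a Boolean `f` on `m` bits of `𝔽_p`-degree `≤ d`, `S = {f = true}`, `N = |S|`,
`h_S(k) = hilbertFn 𝔽_p S k` (the affine Hilbert function of the point set `S`, tree `LowDegreeClosure`):

* (FOLDING)   `#(S ∩ ODD), #(S ∩ EVEN) ≤ h_S(⌊m/2⌋)`            — on a parity class `y^T = ± y^{Tᶜ}`;
* (SYMMETRY)  `h_S(k) + h_S(k') ≤ N` whenever `k + k' + d + 1 ≤ m` — `𝟙_S·P` (deg `≤ k + d`) is orthogonal to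
              `ḡ·𝟙_S·Q` (deg `Q ≤ k'`) because the alternating sum of a function of degree `< m` vanishes;
* (DENSITY)   `h_S(k) ≥ N · P[Bin(m,½) ≤ k]`                     — Nie–Wang / Kopparty–Srinivasan (tree);
* (TAIL)      `P[Bin(m,½) ≤ ⌈m/2⌉ − 1 − d] ≥ ¼` once `m ≥ 16(d+1)²`.

Hence `max(#odd, #even) ≤ N − h_S(⌈m/2⌉−1−d) ≤ ¾·N`: **`RelBal 3 f` for all `m ≥ 16(d+1)²`**, i.e.
threshold `16·(d+1)²` — the law conjectured since lens-4 g5 (`RelSmolensky`, item 29180) is a theorem. -/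

section Hilbert

variable {p : ℕ} [Fact p.Prime] {m : ℕ}

/-- the `𝔽_p`-indicator of the level set (the function `HasDegF` speaks about). -/
def indF (p : ℕ) (f : (Fin m → Bool) → Bool) : CubeFn (ZMod p) m := fun x => if f x then 1 else 0

/-- the level set `{f = true}` as a finset. -/
def levelT (f : (Fin m → Bool) → Bool) : Finset (Fin m → Bool) := univ.filter fun x => f x = true

/-- Relative-Smolensky helper `mem_levelT` (lens-4 g9 HilbertDial; see the enclosing section docstring). -/
theorem mem_levelT {f : (Fin m → Bool) → Bool} {x : Fin m → Bool} : x ∈ levelT f ↔ f x = true := by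
  unfold levelT; simp

/-- pointwise formula for the tree's `projOn` (the library's simp lemma is private). -/
theorem projOn_apply' {F : Type*} [Field F] (Y : Finset (Fin m → Bool)) (v : CubeFn F m) (x : Fin m → Bool) :
    projOn F Y v x = if x ∈ Y then v x else 0 := rfl

/-- restriction to the level set is multiplication by its indicator. -/
theorem projOn_levelT_eq (f : (Fin m → Bool) → Bool) (v : CubeFn (ZMod p) m) :
    projOn (ZMod p) (levelT f) v = indF p f * v := by
  funext x
  rw [projOn_apply', Pi.mul_apply]
  unfold indF
  by_cases hx : f x = true
  · rw [if_pos (mem_levelT.2 hx), if_pos hx, one_mul]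
  · rw [if_neg (fun h => hx (mem_levelT.1 h)), if_neg hx, zero_mul]

/-- Relative-Smolensky helper `indF_mul_indF` (lens-4 g9 HilbertDial; see the enclosing section docstring). -/
theorem indF_mul_indF (f : (Fin m → Bool) → Bool) : indF p f * indF p f = indF p f := by
  funext x; unfold indF; by_cases hx : f x = true <;> simp [hx]

/-- `projOn` is idempotent. -/
theorem projOn_projOn {F : Type*} [Field F] (Y : Finset (Fin m → Bool)) (v : CubeFn F m) :
    projOn F Y (projOn F Y v) = projOn F Y v := by
  funext x; simp only [projOn_apply']; split <;> rfl

/-- every function has degree `≤ m`. -/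
theorem lowDeg_self_eq_top (F : Type*) [Field F] : lowDeg F m m = ⊤ := by
  refine top_le_iff.1 ?_
  rw [← span_range_mono_eq_top, Submodule.span_le]
  rintro _ ⟨T, rfl⟩
  exact mono_mem_lowDeg (by simpa only [Fintype.card_fin] using Finset.card_le_univ T)

/-- the `±1` parity is the sign of `parityFn`. -/
theorem pmMono_univ_eq_sign (x : Fin m → Bool) :
    pmMono (ZMod p) univ x = if parityFn m x = true then (-1 : ZMod p) else 1 := by
  rw [pmMono_univ_apply]
  unfold parityFn Literature.Computability.Complexity.GateFn.numOnes
  by_cases h : Odd (univ.filter fun i => x i = true).card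
  · rw [if_pos h, if_pos]; rw [decide_eq_true_eq]; exact Nat.odd_iff.1 h
  · rw [if_neg h, if_neg]; rw [decide_eq_true_eq]; intro h'; exact h (Nat.odd_iff.2 h')

/-- the alternating sum of a function of degree `< m` vanishes (signed-monomial form). -/
theorem sum_pmMono_univ_mul_eq_zero {D : ℕ} (hD : D < m) {G : CubeFn (ZMod p) m}
    (hG : G ∈ lowDeg (ZMod p) m D) : ∑ x : Fin m → Bool, pmMono (ZMod p) univ x * G x = 0 := by
  have h := altSum_eq_zero p hD hG
  rw [← h]
  exact Finset.sum_congr rfl fun x _ => by rw [pmMono_univ_eq_sign]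

/-! ### (FOLDING) a parity class of the level set has at most `h_S(⌊m/2⌋)` points -/

/-- on a point of parity `b`, `y^U = ε_b · y^{Uᶜ}` with `ε_true = −1`, `ε_false = 1`. -/
theorem pmMono_apply_of_parity (U : Finset (Fin m)) {x : Fin m → Bool} {b : Bool} (hx : parityFn m x = b) :
    pmMono (ZMod p) U x = (if b = true then (-1 : ZMod p) else 1) * pmMono (ZMod p) Uᶜ x := by
  have h := congrFun (pmMono_univ_mul_compl (F := ZMod p) U) x
  rw [Pi.mul_apply, pmMono_univ_eq_sign, hx] at h
  exact h.symm

/-- **FOLDING** (general form): a set of points of the level set, all of parity `b`, has at most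
`h_S(⌊m/2⌋)` elements (`p` odd). -/
theorem card_le_hilbertFn_of_parity (hp2 : p ≠ 2) (f : (Fin m → Bool) → Bool) (b : Bool)
    (A : Finset (Fin m → Bool)) (hA : ∀ z ∈ A, f z = true ∧ parityFn m z = b) :
    A.card ≤ hilbertFn (ZMod p) (levelT f) (m / 2) := by
  -- the space of restrictions to the level set of polynomials of degree `≤ m/2`
  let W : Submodule (ZMod p) (CubeFn (ZMod p) m) := (lowDeg (ZMod p) m (m / 2)).map (projOn (ZMod p) (levelT f))
  -- evaluation on `A`
  let evA : CubeFn (ZMod p) m →ₗ[ZMod p] (A → ZMod p) := LinearMap.funLeft (ZMod p) (ZMod p) (Subtype.val : A → _)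
  have hAS : ∀ a : A, (a : Fin m → Bool) ∈ levelT f := fun a => mem_levelT.2 (hA a.1 a.2).1
  have hApar : ∀ a : A, parityFn m (a : Fin m → Bool) = b := fun a => (hA a.1 a.2).2
  have h2 : (2 : ZMod p) ≠ 0 := by
    intro h
    have h2' : ((2 : ℕ) : ZMod p) = 0 := by exact_mod_cast h
    rw [ZMod.natCast_eq_zero_iff] at h2'
    exact hp2 ((Nat.prime_dvd_prime_iff_eq Fact.out Nat.prime_two).1 h2')
  have evA_apply : ∀ (v : CubeFn (ZMod p) m) (a : A), evA v a = v a := fun v a => rfl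
  -- every signed monomial, evaluated on `A`, comes from `W`
  have hpm : ∀ U : Finset (Fin m), evA (pmMono (ZMod p) U) ∈ W.map evA := by
    intro U
    by_cases hU : U.card ≤ m / 2
    · refine ⟨projOn (ZMod p) (levelT f) (pmMono (ZMod p) U),
        Submodule.mem_map_of_mem (pmMono_mem_lowDeg hU), ?_⟩
      funext a
      rw [evA_apply, evA_apply, projOn_apply', if_pos (hAS a)]
    · have hUc : Uᶜ.card ≤ m / 2 := by
        rw [Finset.card_compl, Fintype.card_fin]; omega
      refine ⟨projOn (ZMod p) (levelT f) ((if b = true then (-1 : ZMod p) else 1) • pmMono (ZMod p) Uᶜ),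
        Submodule.mem_map_of_mem (Submodule.smul_mem _ _ (pmMono_mem_lowDeg hUc)), ?_⟩
      funext a
      rw [evA_apply, evA_apply, projOn_apply', if_pos (hAS a), Pi.smul_apply, smul_eq_mul,
        pmMono_apply_of_parity U (hApar a)]
  -- hence `W` maps ONTO the functions on `A`
  have htop : W.map evA = ⊤ := by
    refine top_le_iff.1 ?_
    have hsurj : Function.Surjective evA :=
      LinearMap.funLeft_surjective_of_injective _ _ _ Subtype.val_injective
    intro g _
    obtain ⟨v, rfl⟩ := hsurj g
    have hv : v ∈ Submodule.span (ZMod p) (Set.range (mono (ZMod p) (n := m))) := by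
      rw [span_range_mono_eq_top]; exact Submodule.mem_top
    rw [← Submodule.mem_comap]
    refine (Submodule.span_le.2 ?_) hv
    rintro _ ⟨T, rfl⟩
    rw [SetLike.mem_coe, Submodule.mem_comap]
    have hT : mono (ZMod p) T = ((2 : ZMod p) ^ T.card)⁻¹ • ((2 : ZMod p) ^ T.card • mono (ZMod p) T) := by
      rw [smul_smul, inv_mul_cancel₀ (pow_ne_zero _ h2), one_smul]
    rw [hT, two_pow_smul_mono_eq_sum, map_smul, map_sum]
    refine Submodule.smul_mem _ _ (Submodule.sum_mem _ fun U _ => ?_)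
    rw [map_smul]
    exact Submodule.smul_mem _ _ (hpm U)
  -- count dimensions
  calc A.card = Module.finrank (ZMod p) (A → ZMod p) := by
        rw [Module.finrank_fintype_fun_eq_card, Fintype.card_coe]
    _ = Module.finrank (ZMod p) (W.map evA) := by rw [htop, finrank_top]
    _ ≤ Module.finrank (ZMod p) W := Submodule.finrank_map_le _ _
    _ = hilbertFn (ZMod p) (levelT f) (m / 2) := rfl

/-- **FOLDING.** `#{f = true, parity = b} ≤ h_S(⌊m/2⌋)` (`p` odd). -/
theorem card_parityPart_le_hilbertFn (hp2 : p ≠ 2) (f : (Fin m → Bool) → Bool) (b : Bool) :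
    (univ.filter fun z : Fin m → Bool => f z = true ∧ parityFn m z = b).card ≤
      hilbertFn (ZMod p) (levelT f) (m / 2) :=
  card_le_hilbertFn_of_parity hp2 f b _ fun _ hz => (mem_filter.1 hz).2

/-- Relative-Smolensky helper `card_oddPart_le_hilbertFn` (lens-4 g9 HilbertDial; see the enclosing section docstring). -/
theorem card_oddPart_le_hilbertFn (hp2 : p ≠ 2) (f : (Fin m → Bool) → Bool) :
    (oddPart f).card ≤ hilbertFn (ZMod p) (levelT f) (m / 2) :=
  card_parityPart_le_hilbertFn hp2 f true

/-- Relative-Smolensky helper `card_evenPart_le_hilbertFn` (lens-4 g9 HilbertDial; see the enclosing section docstring). -/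
theorem card_evenPart_le_hilbertFn (hp2 : p ≠ 2) (f : (Fin m → Bool) → Bool) :
    (evenPart f).card ≤ hilbertFn (ZMod p) (levelT f) (m / 2) :=
  card_parityPart_le_hilbertFn hp2 f false


end Hilbert
end Summit.QuantumAdvantage.QuantumAdvantage.Theorems.PairFreezing
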